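import Literature.Analysis.FluidPDE.TorusWeakNSGluing
import Literature.Analysis.FluidPDE.LerayHopfTimeSliceTorus
import Literature.Analysis.FluidPDE.LerayHopfTranslate
import Literature.Analysis.FluidPDE.NSHopfEnergy
import Literature.Analysis.FunctionSpaces.TimeMollification
import HarnessLib

/-!
# Tools for time translation of forced Leray–Hopf solutions on the flat torus

Analysis/FluidPDE support file (all proved). Torus twin of the first half of
`Literature.Analysis.FluidPDE.LerayHopfTranslate` / `LerayHopfRestart` (which are stated on a
Euclidean space `E` for the UNFORCED system): the bookkeeping needed to restart a Leray–Hopf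
weak solution `Torus.IsLerayHopfOn T ν (fun _ => g) u₀ u` of the Navier–Stokes equations on
`T^d × [0, T)` driven by a STEADY force `g` at an intermediate time `s`, i.e. to show that the
translate `u(· + s)` is again Leray–Hopf from the datum `u(s)` (Robinson–Rodrigo–Sadowski 2016,
Def. 3.3 (ii), Def. 4.9 and Cor. 4.8; Leray 1934, §III (5.1)–(5.2)):

* the time shear `(t, y) ↦ (t + s, y)` on `(0, T) × ℝ^d` (measure preserving onto
  `(s, T + s) × ℝ^d`), measurability and square integrability of the translate
  (`measurePreserving_prodMap_add_right_Ioo`, `aestronglyMeasurable_stLift_translate`,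
  `lintegral_translate_le`);
* the forced weak formulation tested with a product `η(t) ψ(t, x)` of a smooth function of time
  and a (time-dependent) divergence-free test field (`IsWeakNSSolutionForcedOn.test_smul_time`;
  Temam 1984, Ch. III (1.22)–(1.24)) — the forced twin of
  `Torus.IsWeakNSSolutionWithDataOn.test_smul_time` (`TorusWeakNSGluing`);
* strong right-continuity in `L²` at a time from which the kinetic energy does not increase up
  to an error `R(t) → 0` (`IsLerayHopfOn.tendsto_eLpNorm_sub_nhdsGT_of_le_add`; Robinson–Rodrigo–
  Sadowski 2016, Cor. 4.8 — with a force the energy inequality from `s` gives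
  `E(u(t)) ≤ E(u(s)) + ∫ₛᵗ⟨g, u⟩`);
* the right limit at `0⁺` of the pairing `t ↦ ∫⟪u(t + s), ψ(t)⟫` with a test field, from the
  strong right-continuity at `s` (`tendsto_integral_inner_translate_nhdsGT`).

The weak identity of the translate (cut-off argument) and the Leray–Hopf structure of the
translate are in `LerayHopfTranslateTorus` and `LerayHopfRestartTorus`.

## References

* J. C. Robinson, J. L. Rodrigo, W. Sadowski, *The three-dimensional Navier–Stokes equations*
  (CUP 2016), Def. 3.3, §3.1 p. 58, Def. 4.9, Cor. 4.8. [RobinsonRodrigoSadowski2016]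
* R. Temam, *Navier–Stokes Equations*, 3rd ed. (1984), Ch. III §1.1, (1.22)–(1.25).
* J. Leray, Acta Math. 63 (1934), §III. [Leray1934]
-/

noncomputable section

open MeasureTheory TopologicalSpace Set Function Filter Topology InnerProductSpace
open scoped RealInnerProductSpace ENNReal NNReal ContDiff

namespace Literature.Analysis.FluidPDE.Torus

variable {d : Type*} [Fintype d] [DecidableEq d]

/-! ### The time shear `(t, y) ↦ (t + s, y)` on finite slabs -/

section Shear

omit [DecidableEq d]

omit [Fintype d] in
/-- The time shear `(t, y) ↦ (t + s, y)` of `ℝ × ℝ^d` carries Lebesgue measure on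
`(0, T) × ℝ^d` to Lebesgue measure on `(s, T + s) × ℝ^d`. [folklore] -/
theorem measurePreserving_prodMap_add_right_Ioo [Fintype d] (s T : ℝ) :
    MeasurePreserving (Prod.map (fun t : ℝ => t + s) (id : EuclideanSpace ℝ d → EuclideanSpace ℝ d))
      (volume.restrict (Ioo 0 T ×ˢ univ)) (volume.restrict (Ioo s (T + s) ×ˢ univ)) := by
  have h0 : MeasurePreserving (Prod.map (fun t : ℝ => t + s) (id : EuclideanSpace ℝ d → EuclideanSpace ℝ d))
      volume volume :=
    (measurePreserving_add_right volume s).prod (MeasurePreserving.id volume)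
  have h := h0.restrict_preimage ((measurableSet_Ioo (a := s) (b := T + s)).prod MeasurableSet.univ)
  have hpre : Prod.map (fun t : ℝ => t + s) (id : EuclideanSpace ℝ d → EuclideanSpace ℝ d) ⁻¹'
      (Ioo s (T + s) ×ˢ univ) = Ioo 0 T ×ˢ univ := by
    ext p
    simp only [mem_preimage, mem_prod, Prod.map_fst, Prod.map_snd, mem_Ioo, mem_univ, and_true]
    constructor <;> rintro ⟨h1, h2⟩ <;> constructor <;> linarith
  rwa [hpre] at h

/-- **Measurability of the translate.** If the space–time lift of `u` is a.e. strongly measurable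
on `(0, T') × ℝ^d` and `0 ≤ s`, `T + s ≤ T'`, then so is the lift of `u(· + s)` on
`(0, T) × ℝ^d`. [folklore] -/
theorem aestronglyMeasurable_stLift_translate {F : Type*} [TopologicalSpace F]
    {u : ℝ → UnitAddTorus d → F} {T T' s : ℝ} (hs : 0 ≤ s) (hT : T + s ≤ T')
    (hu : AEStronglyMeasurable (FunctionSpaces.Torus.stLift u) (volume.restrict (Ioo 0 T' ×ˢ univ))) :
    AEStronglyMeasurable (FunctionSpaces.Torus.stLift fun t => u (t + s))
      (volume.restrict (Ioo 0 T ×ˢ (univ : Set (EuclideanSpace ℝ d)))) := by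
  have hsub : Ioo s (T + s) ×ˢ (univ : Set (EuclideanSpace ℝ d)) ⊆ Ioo 0 T' ×ˢ univ :=
    prod_mono (fun t ht => ⟨hs.trans_lt ht.1, ht.2.trans_le hT⟩) Subset.rfl
  have hu' := hu.mono_measure (Measure.restrict_mono hsub le_rfl)
  have hg : (FunctionSpaces.Torus.stLift fun t => u (t + s)) =
      FunctionSpaces.Torus.stLift u ∘ Prod.map (fun t : ℝ => t + s) id := by
    funext p
    rfl
  rw [hg]
  exact hu'.comp_measurePreserving (measurePreserving_prodMap_add_right_Ioo s T)

/-- **Square integrability of the translate**: for `0 ≤ s`, `T + s ≤ T'`,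
`∫₀ᵀ ∫ ‖u(t + s)‖² ≤ ∫₀^{T'} ∫ ‖u‖²` (change of variables and monotonicity). [folklore] -/
theorem lintegral_translate_le {F : Type*} [NormedAddCommGroup F] {u : ℝ → UnitAddTorus d → F}
    {T T' s : ℝ} (hs : 0 ≤ s) (hT : T + s ≤ T') :
    ∫⁻ t in Ioo 0 T, ∫⁻ x, ‖u (t + s) x‖ₑ ^ 2 ≤ ∫⁻ t in Ioo 0 T', ∫⁻ x, ‖u t x‖ₑ ^ 2 := by
  rw [setLIntegral_Ioo_comp_add_right (fun t => ∫⁻ x, ‖u t x‖ₑ ^ 2) 0 T s, zero_add]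
  exact lintegral_mono_set fun t ht => ⟨hs.trans_lt ht.1, ht.2.trans_le hT⟩

end Shear

/-! ### The forced weak formulation tested with `η(t) ψ(t, x)` -/

section TestSmulTime

variable {T ν : ℝ} {g : UnitAddTorus d → EuclideanSpace ℝ d}
  {u : ℝ → UnitAddTorus d → EuclideanSpace ℝ d} {u₀ : UnitAddTorus d → EuclideanSpace ℝ d}
  {ψ : ℝ → UnitAddTorus d → EuclideanSpace ℝ d}

/-- **The forced weak formulation with datum tested with a product `η(t) ψ(t, x)`.** Let `u` be a
forced weak solution with datum `u₀` on `T^d × [0, T)` driven by a steady integrable force `g`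
(`Torus.IsWeakNSSolutionForcedOn T ν (fun _ => g) u₀ u`), `ψ` a smooth divergence-free test field
on `[0, T)` and `η ∈ C^∞(ℝ)`. With `P(t) = ∫⟪u(t), ψ(t)⟫` and
`Φ(t) = ∫ (⟪u, ∂ₜψ⟫ + ⟪u, (u·∇)ψ⟫ + ν⟪u, Δψ⟫ + ⟪g, ψ⟫)(t)`,
`∫_{(0,T)} (η' P + η Φ) + η(0) ∫⟪u₀, ψ(0)⟫ = 0` (product rule in time and linearity of the
space operators in the test field; Temam 1984, Ch. III (1.22)–(1.24)). Forced twin of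
`Torus.IsWeakNSSolutionWithDataOn.test_smul_time`. [folklore] -/
theorem IsWeakNSSolutionForcedOn.test_smul_time
    (hu : IsWeakNSSolutionForcedOn T ν (fun _ => g) u₀ u) (hg : Integrable g volume)
    (hψ : FunctionSpaces.Torus.IsSpaceTimeTest T ψ) (hdiv : FunctionSpaces.Torus.IsDivFreeTest ψ)
    {η : ℝ → ℝ} (hη : ContDiff ℝ ∞ η) :
    (∫ t in Ioo 0 T, (deriv η t * (∫ x, ⟪u t x, ψ t x⟫) + η t *
      ∫ x, (⟪u t x, FunctionSpaces.Torus.timeDeriv ψ t x⟫ +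
        ⟪u t x, FunctionSpaces.Torus.convect (u t) (ψ t) x⟫ +
        ν * ⟪u t x, FunctionSpaces.Torus.laplacian (ψ t) x⟫ + ⟪g x, ψ t x⟫))) +
      η 0 * ∫ x, ⟪u₀ x, ψ 0 x⟫ = 0 := by
  obtain ⟨hm, h2, -, hweak⟩ := hu
  have hid := hweak (fun t x => η t • ψ t x) (isSpaceTimeTest_smul_time hη hψ)
    (isDivFreeTest_smul' η hdiv)
  have hinit : ∫ x, ⟪u₀ x, η 0 • ψ 0 x⟫ = η 0 * ∫ x, ⟪u₀ x, ψ 0 x⟫ := by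
    simp only [real_inner_smul_right]
    exact integral_const_mul _ _
  have hslice : ∀ᵐ t ∂(volume.restrict (Ioo 0 T)),
      ∫ x, (⟪u t x, FunctionSpaces.Torus.timeDeriv (fun s y => η s • ψ s y) t x⟫ +
        ⟪u t x, FunctionSpaces.Torus.convect (u t) (fun y => η t • ψ t y) x⟫ +
        ν * ⟪u t x, FunctionSpaces.Torus.laplacian (fun y => η t • ψ t y) x⟫ +
        ⟪g x, η t • ψ t x⟫) =
      deriv η t * (∫ x, ⟪u t x, ψ t x⟫) + η t *
        ∫ x, (⟪u t x, FunctionSpaces.Torus.timeDeriv ψ t x⟫ +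
          ⟪u t x, FunctionSpaces.Torus.convect (u t) (ψ t) x⟫ +
          ν * ⟪u t x, FunctionSpaces.Torus.laplacian (ψ t) x⟫ + ⟪g x, ψ t x⟫) := by
    filter_upwards [ae_memLp_two_slice_of_lintegral hm h2] with t ht
    have hC1 : FunctionSpaces.Torus.IsContDiff 1 (ψ t) := (hψ.isSmooth_slice t).isContDiff (by simp)
    have hpt : ∀ x, ⟪u t x, FunctionSpaces.Torus.timeDeriv (fun s y => η s • ψ s y) t x⟫ +
        ⟪u t x, FunctionSpaces.Torus.convect (u t) (fun y => η t • ψ t y) x⟫ +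
        ν * ⟪u t x, FunctionSpaces.Torus.laplacian (fun y => η t • ψ t y) x⟫ +
        ⟪g x, η t • ψ t x⟫ =
        deriv η t * ⟪u t x, ψ t x⟫ + η t * (⟪u t x, FunctionSpaces.Torus.timeDeriv ψ t x⟫ +
          ⟪u t x, FunctionSpaces.Torus.convect (u t) (ψ t) x⟫ +
          ν * ⟪u t x, FunctionSpaces.Torus.laplacian (ψ t) x⟫ + ⟪g x, ψ t x⟫) := by
      intro x
      rw [timeDeriv_smul' (hη.differentiable (by simp)) hψ.1, convect_const_smul (u t) hC1 (η t) x,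
        laplacian_const_smul (hψ.isSmooth_slice t) (η t) x]
      simp only [inner_add_right, real_inner_smul_right]
      ring
    have hi : Integrable (u t) volume := ht.integrable one_le_two
    have i1 : Integrable (fun x => ⟪u t x, ψ t x⟫) volume :=
      FunctionSpaces.Torus.integrable_inner_of_continuous hi (hψ.isSmooth_slice t).continuous
    have i2 : Integrable (fun x => ⟪u t x, FunctionSpaces.Torus.timeDeriv ψ t x⟫ +
        ⟪u t x, FunctionSpaces.Torus.convect (u t) (ψ t) x⟫ +
        ν * ⟪u t x, FunctionSpaces.Torus.laplacian (ψ t) x⟫ + ⟪g x, ψ t x⟫) volume :=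
      (((FunctionSpaces.Torus.integrable_inner_of_continuous hi
        (hψ.timeDeriv.isSmooth_slice t).continuous).add
        (FunctionSpaces.Torus.integrable_inner_convect_slice hψ ht)).add
        ((FunctionSpaces.Torus.integrable_inner_of_continuous hi
          (hψ.isSmooth_slice t).laplacian.continuous).const_mul ν)).add
        (FunctionSpaces.Torus.integrable_inner_of_continuous hg (hψ.isSmooth_slice t).continuous)
    calc ∫ x, (⟪u t x, FunctionSpaces.Torus.timeDeriv (fun s y => η s • ψ s y) t x⟫ +
          ⟪u t x, FunctionSpaces.Torus.convect (u t) (fun y => η t • ψ t y) x⟫ +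
          ν * ⟪u t x, FunctionSpaces.Torus.laplacian (fun y => η t • ψ t y) x⟫ +
          ⟪g x, η t • ψ t x⟫)
        = ∫ x, (deriv η t * ⟪u t x, ψ t x⟫ + η t * (⟪u t x, FunctionSpaces.Torus.timeDeriv ψ t x⟫ +
            ⟪u t x, FunctionSpaces.Torus.convect (u t) (ψ t) x⟫ +
            ν * ⟪u t x, FunctionSpaces.Torus.laplacian (ψ t) x⟫ + ⟪g x, ψ t x⟫)) :=
          integral_congr_ae (ae_of_all _ hpt)
      _ = _ := by
          rw [integral_add (i1.const_mul _) (i2.const_mul _), integral_const_mul, integral_const_mul]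
  rw [integral_congr_ae hslice, hinit] at hid
  exact hid

end TestSmulTime

/-! ### Strong `L²` right-continuity at a time from which the energy almost decreases -/

section StrongContinuity

variable {T ν : ℝ} {f u : ℝ → UnitAddTorus d → EuclideanSpace ℝ d}
  {u₀ : UnitAddTorus d → EuclideanSpace ℝ d}

omit [DecidableEq d] in
/-- The kinetic energy of a difference of `L²` fields on the torus:
`E(v - w) = E(v) - ∫⟪v, w⟫ + E(w)` (`‖a - b‖² = ‖a‖² - 2⟪a, b⟫ + ‖b‖²` integrated). Torus twin
of `Literature.Analysis.FluidPDE.kineticEnergy_sub`. [folklore] -/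
theorem kineticEnergy_sub {v w : UnitAddTorus d → EuclideanSpace ℝ d} (hv : MemLp v 2 volume)
    (hw : MemLp w 2 volume) :
    FunctionSpaces.Torus.kineticEnergy (v - w) =
      FunctionSpaces.Torus.kineticEnergy v - (∫ x, ⟪v x, w x⟫) +
        FunctionSpaces.Torus.kineticEnergy w := by
  have h1 : Integrable (fun x => ‖v x‖ ^ 2) volume := hv.integrable_norm_pow two_ne_zero
  have h2 : Integrable (fun x => ‖w x‖ ^ 2) volume := hw.integrable_norm_pow two_ne_zero
  have h3 : Integrable (fun x => ⟪v x, w x⟫) volume :=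
    (hv.norm.integrable_mul hw.norm).mono' (hv.1.inner hw.1)
      (ae_of_all _ fun x => norm_inner_le_norm (v x) (w x))
  have hpt : (fun x => ‖(v - w) x‖ ^ 2) = fun x => ‖v x‖ ^ 2 - 2 * ⟪v x, w x⟫ + ‖w x‖ ^ 2 := by
    funext x
    rw [Pi.sub_apply, norm_sub_sq_real]
  have h4 : Integrable (fun x => ‖v x‖ ^ 2 - 2 * ⟪v x, w x⟫) volume := h1.sub (h3.const_mul 2)
  simp only [FunctionSpaces.Torus.kineticEnergy]
  rw [hpt, integral_add h4 h2, integral_sub h1 (h3.const_mul 2), integral_const_mul]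
  ring

/-- **Strong right-continuity in `L²` from an almost non-increasing energy** (Robinson–Rodrigo–
Sadowski 2016, Cor. 4.8 with Lemma A.20, forced form). Let `u` be a Leray–Hopf weak solution on
`T^d × [0, T)` and `s ∈ (0, T)` a time such that `E(u(t)) ≤ E(u(s)) + R(t)` for `t ∈ [s, T]`
with `R(t) → 0` as `t → s⁺` (as given by the energy inequality from `s`, the work of the force
`R(t) = ∫ₛᵗ⟨f, u⟩` tending to zero). Then `‖u(t) - u(s)‖_{L²} → 0` as `t → s⁺`:
`2E(u(t) - u(s)) = 2E(u(t)) - 2∫⟪u(t), u(s)⟫ + 2E(u(s)) ≤ 4E(u(s)) + 2R(t) - 2∫⟪u(t), u(s)⟫ → 0`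
by weak continuity tested against `u(s) ∈ L²`. [cite: RobinsonRodrigoSadowski2016, Cor. 4.8 (with Lemma A.20)] -/
theorem IsLerayHopfOn.tendsto_eLpNorm_sub_nhdsGT_of_le_add (h : IsLerayHopfOn T ν f u₀ u) {s : ℝ}
    (hs : s ∈ Ioo 0 T) {R : ℝ → ℝ} (hR : Tendsto R (𝓝[>] s) (𝓝 0))
    (hE : ∀ t ∈ Icc s T, FunctionSpaces.Torus.kineticEnergy (u t) ≤
      FunctionSpaces.Torus.kineticEnergy (u s) + R t) :
    Tendsto (fun t => eLpNorm (u t - u s) 2 volume) (𝓝[>] s) (𝓝 0) := by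
  have hvs : MemLp (u s) 2 volume := h.memLp s ⟨hs.1.le, hs.2.le⟩
  set P : ℝ → ℝ := fun t => ∫ x, ⟪u t x, u s x⟫ with hP
  -- weak continuity tested against `u s`
  have hPc : Tendsto P (𝓝[>] s) (𝓝 (P s)) :=
    (((h.weak_continuous (u s) hvs).1.continuousAt (Ioc_mem_nhds hs.1 hs.2)).tendsto).mono_left
      nhdsWithin_le_nhds
  have hPs : P s = 2 * FunctionSpaces.Torus.kineticEnergy (u s) := by
    simp only [hP, FunctionSpaces.Torus.kineticEnergy, real_inner_self_eq_norm_sq]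
    ring
  -- the energy of the difference tends to zero
  have hev : ∀ᶠ t in 𝓝[>] s, t ∈ Ioo s T := Ioo_mem_nhdsGT hs.2
  have hKE : Tendsto (fun t => FunctionSpaces.Torus.kineticEnergy (u t - u s)) (𝓝[>] s) (𝓝 0) := by
    have hup : Tendsto (fun t => 2 * FunctionSpaces.Torus.kineticEnergy (u s) + R t - P t)
        (𝓝[>] s) (𝓝 0) := by
      have := ((tendsto_const_nhds (x := 2 * FunctionSpaces.Torus.kineticEnergy (u s))).add hR).sub hPc
      rwa [hPs, add_zero, sub_self] at this
    refine tendsto_of_tendsto_of_tendsto_of_le_of_le' tendsto_const_nhds hup ?_ ?_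
    · exact Eventually.of_forall fun t => FunctionSpaces.Torus.kineticEnergy_nonneg _
    · filter_upwards [hev] with t ht
      have hut : MemLp (u t) 2 volume := h.memLp t ⟨hs.1.le.trans ht.1.le, ht.2.le⟩
      rw [kineticEnergy_sub hut hvs]
      have := hE t ⟨ht.1.le, ht.2.le⟩
      show FunctionSpaces.Torus.kineticEnergy (u t) - P t + FunctionSpaces.Torus.kineticEnergy (u s) ≤
        2 * FunctionSpaces.Torus.kineticEnergy (u s) + R t - P t
      linarith
  -- convert to the `L²` norm: `‖w‖₂ = (∫⁻ ‖w‖ₑ²)^{1/2}` and `∫⁻ ‖w‖ₑ² = ofReal (2 E(w))`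
  have hE2 : Tendsto (fun t => ∫⁻ x, ‖(u t - u s) x‖ₑ ^ 2) (𝓝[>] s) (𝓝 0) := by
    have h1 : Tendsto (fun t => ENNReal.ofReal (2 * FunctionSpaces.Torus.kineticEnergy (u t - u s)))
        (𝓝[>] s) (𝓝 0) := by
      have := ENNReal.tendsto_ofReal (hKE.const_mul 2)
      rwa [mul_zero, ENNReal.ofReal_zero] at this
    refine h1.congr' ?_
    filter_upwards [hev] with t ht
    have hut : MemLp (u t) 2 volume := h.memLp t ⟨hs.1.le.trans ht.1.le, ht.2.le⟩
    rw [lintegral_enorm_sq_eq_ofReal (hut.sub hvs)]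
    simp only [FunctionSpaces.Torus.kineticEnergy]
    congr 1
    ring
  have h3 : Tendsto (fun t => (∫⁻ x, ‖(u t - u s) x‖ₑ ^ 2) ^ (2⁻¹ : ℝ)) (𝓝[>] s) (𝓝 0) := by
    have := (ENNReal.continuous_rpow_const (y := (2⁻¹ : ℝ))).tendsto 0 |>.comp hE2
    rwa [ENNReal.zero_rpow_of_pos (by norm_num)] at this
  refine h3.congr fun t => ?_
  rw [eLpNorm_eq_lintegral_rpow_enorm_toReal two_ne_zero ENNReal.ofNat_ne_top]
  simp only [ENNReal.toReal_ofNat, one_div]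
  congr 1
  refine lintegral_congr fun x => ?_
  rw [← ENNReal.rpow_natCast]
  norm_num

end StrongContinuity

/-! ### The pairing of the translate with a test field at `t → 0⁺` -/

section Pairing

variable {T : ℝ} {u : ℝ → UnitAddTorus d → EuclideanSpace ℝ d}
  {ψ : ℝ → UnitAddTorus d → EuclideanSpace ℝ d}

omit [DecidableEq d] in
/-- **The pairing `t ↦ ∫⟪u(t + s), ψ(t)⟫` at `0⁺`.** If `u(τ) ∈ L²` for `τ ∈ [s, s + T]`,
`T > 0`, `‖u(τ) - u(s)‖_{L²} → 0` as `τ → s⁺`, and `ψ` is a space–time test field, then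
`∫⟪u(t + s), ψ(t)⟫ → ∫⟪u(s), ψ(0)⟫` as `t → 0⁺`: split
`⟪u(t+s), ψ(t)⟫ - ⟪u(s), ψ(0)⟫ = ⟪u(t+s) - u(s), ψ(t)⟫ + ⟪u(s), ψ(t) - ψ(0)⟫`, bound the first
pairing by Cauchy–Schwarz and the second by dominated convergence (`ψ` jointly continuous and
bounded). [folklore] -/
theorem tendsto_integral_inner_translate_nhdsGT {S : ℝ} (hψ : FunctionSpaces.Torus.IsSpaceTimeTest S ψ)
    {s : ℝ} (hT : 0 < T) (hmem : ∀ τ ∈ Icc s (s + T), MemLp (u τ) 2 volume)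
    (h0 : Tendsto (fun τ => eLpNorm (u τ - u s) 2 volume) (𝓝[>] s) (𝓝 0)) :
    Tendsto (fun t => ∫ x, ⟪u (t + s) x, ψ t x⟫) (𝓝[>] 0) (𝓝 (∫ x, ⟪u s x, ψ 0 x⟫)) := by
  have hvs : MemLp (u s) 2 volume := hmem s ⟨le_rfl, by linarith⟩
  -- a uniform bound for `ψ` on `[0, T] × T^d`
  obtain ⟨K, hK⟩ := hψ.exists_bound (isCompact_Icc (a := -T) (b := T))
  have hK0 : 0 ≤ K := (norm_nonneg _).trans (hK 0 ⟨by linarith, hT.le⟩ 0)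
  have hψc : Continuous (uncurry ψ) := hψ.continuous_uncurry
  have hψt : ∀ t, Continuous (ψ t) := fun t => hψc.comp (Continuous.prodMk_right t)
  have hψmem : ∀ t, MemLp (ψ t) 2 volume := fun t => (hψ.isSmooth_slice t).memLp 2
  -- the shift `t ↦ t + s` at the filters `𝓝[>] 0 → 𝓝[>] s`
  have hsh : Tendsto (fun t : ℝ => t + s) (𝓝[>] (0 : ℝ)) (𝓝[>] s) := by
    have h2 : Tendsto (fun t : ℝ => t + s) (𝓝 0) (𝓝 (0 + s)) :=
      (continuous_id.add continuous_const).tendsto 0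
    rw [zero_add] at h2
    refine tendsto_nhdsWithin_iff.2 ⟨h2.mono_left nhdsWithin_le_nhds, ?_⟩
    filter_upwards [self_mem_nhdsWithin] with t ht
    exact show s < t + s by linarith [mem_Ioi.1 ht]
  have hev : ∀ᶠ t in 𝓝[>] (0 : ℝ), t ∈ Ioo 0 T := Ioo_mem_nhdsGT hT
  -- first piece: `∫⟪u(t+s) - u(s), ψ t⟫ → 0` by Cauchy–Schwarz
  have hA : Tendsto (fun t => ∫ x, ⟪u (t + s) x - u s x, ψ t x⟫) (𝓝[>] 0) (𝓝 0) := by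
    have hnorm : Tendsto (fun t => (eLpNorm (u (t + s) - u s) 2 volume).toReal * K) (𝓝[>] 0)
        (𝓝 (0 * K)) := by
      refine Tendsto.mul_const K ?_
      have h1 := h0.comp hsh
      have h2 := (ENNReal.tendsto_toReal ENNReal.zero_ne_top).comp h1
      rwa [ENNReal.toReal_zero] at h2
    rw [zero_mul] at hnorm
    refine squeeze_zero_norm' ?_ hnorm
    filter_upwards [hev] with t ht
    have hut : MemLp (u (t + s)) 2 volume := hmem (t + s) ⟨by linarith [ht.1], by linarith [ht.2]⟩
    have hdiff : MemLp (u (t + s) - u s) 2 volume := hut.sub hvs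
    rw [Real.norm_eq_abs]
    have hcs : |∫ x, ⟪(u (t + s) - u s) x, ψ t x⟫| ≤
        (eLpNorm (u (t + s) - u s) 2 volume).toReal * (eLpNorm (ψ t) 2 volume).toReal := by
      rw [← ENNReal.toReal_mul, ← Real.norm_eq_abs, ← toReal_enorm]
      exact ENNReal.toReal_mono (ENNReal.mul_ne_top hdiff.eLpNorm_ne_top (hψmem t).eLpNorm_ne_top)
        (FunctionSpaces.enorm_integral_inner_le_eLpNorm_mul hdiff.1 (hψmem t).1)
    have hψn : (eLpNorm (ψ t) 2 volume).toReal ≤ K := by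
      have hb : eLpNorm (ψ t) 2 volume ≤ ENNReal.ofReal K := by
        refine (eLpNorm_le_of_ae_bound (C := K) (ae_of_all _ fun x => hK t
          ⟨by linarith [ht.1], ht.2.le⟩ x)).trans ?_
        simp [measure_univ]
      exact (ENNReal.toReal_mono ENNReal.ofReal_ne_top hb).trans_eq (ENNReal.toReal_ofReal hK0)
    calc |∫ x, ⟪u (t + s) x - u s x, ψ t x⟫|
        = |∫ x, ⟪(u (t + s) - u s) x, ψ t x⟫| := by rfl
      _ ≤ (eLpNorm (u (t + s) - u s) 2 volume).toReal * (eLpNorm (ψ t) 2 volume).toReal := hcs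
      _ ≤ (eLpNorm (u (t + s) - u s) 2 volume).toReal * K :=
          mul_le_mul_of_nonneg_left hψn ENNReal.toReal_nonneg
  -- second piece: `∫⟪u(s), ψ t - ψ 0⟫ → 0` by dominated convergence
  have hB : Tendsto (fun t => ∫ x, ⟪u s x, ψ t x⟫) (𝓝[>] 0) (𝓝 (∫ x, ⟪u s x, ψ 0 x⟫)) := by
    have hint : Integrable (u s) volume := hvs.integrable one_le_two
    refine tendsto_integral_filter_of_dominated_convergence (fun x => ‖u s x‖ * K) ?_ ?_
      (hint.norm.mul_const K) ?_
    · exact Eventually.of_forall fun t => hint.aestronglyMeasurable.inner (hψt t).aestronglyMeasurable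
    · filter_upwards [hev] with t ht
      exact ae_of_all _ fun x => (norm_inner_le_norm _ _).trans
        (mul_le_mul_of_nonneg_left (hK t ⟨by linarith [ht.1], ht.2.le⟩ x) (norm_nonneg _))
    · refine ae_of_all _ fun x => ?_
      have hc : Continuous fun t => ⟪u s x, ψ t x⟫ :=
        continuous_const.inner (hψc.comp (continuous_id.prodMk continuous_const))
      exact (hc.tendsto 0).mono_left nhdsWithin_le_nhds
  -- assemble
  have hsum := hA.add hB
  rw [zero_add] at hsum
  refine hsum.congr' ?_
  filter_upwards [hev] with t ht
  have hut : MemLp (u (t + s)) 2 volume := hmem (t + s) ⟨by linarith [ht.1], by linarith [ht.2]⟩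
  have i1 : Integrable (fun x => ⟪u (t + s) x - u s x, ψ t x⟫) volume :=
    FunctionSpaces.Torus.integrable_inner_of_continuous
      ((hut.sub hvs).integrable one_le_two) (hψt t)
  have i2 : Integrable (fun x => ⟪u s x, ψ t x⟫) volume :=
    FunctionSpaces.Torus.integrable_inner_of_continuous (hvs.integrable one_le_two) (hψt t)
  rw [← integral_add i1 i2]
  refine integral_congr_ae (ae_of_all _ fun x => ?_)
  simp only [inner_sub_left]
  ring

end Pairing


end Literature.Analysis.FluidPDE.Torus

end
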